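import Literature.Analysis.Complex.OsgoodProofs
import Mathlib.Analysis.Calculus.InverseFunctionTheorem.ContDiff
import Mathlib.Geometry.Manifold.MFDeriv.Atlas
import HarnessLib

/-!
# The holomorphic implicit function theorem in straightening form, with holomorphic straightening maps

Layer `Literature/Geometry/Kaehler`. P. Griffiths, J. Harris, *Principles of Algebraic Geometry*
(1978), Ch. 0 §1 (holomorphic inverse and implicit function theorems) and §2 pp. 18–20: if
`f = (f₁, …, f_p)` is holomorphic near `x` on an `n`-dimensional complex manifold with
`rank J(f)(x) = p`, then there are holomorphic coordinates `(f₁, …, f_p, w₁, …, w_{n-p})` near `x`.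
The tree's `Literature.Geometry.Kaehler.exists_straightening_of_hasStrictFDerivAt`
(`RegularPointStraightening`) records the topological content (an open partial homeomorphism `e`
with `Z = {(e ·).1 = 0}`); this file proves the HOLOMORPHIC content needed to make zero loci complex
manifolds:

* `exists_holStraightening` — for `f : M → ℂᵖ` holomorphic on an open `U ∋ x` with onto differential
  at `x` and `dim E = p + d`, an open partial homeomorphism `e : M ⇀ ℂᵖ × ℂᵈ` with `x ∈ e.source ⊆ U`,
  **`e` holomorphic on its source, `e⁻¹` holomorphic on its target, and first component `(e y).1 = f y`**.

Proof: in the chart `φ` at `x` the map `g = f ∘ φ⁻¹` is analytic (Osgood); choosing a linear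
`λ : E → ℂᵈ` which is an isomorphism on `ker Dg(φ x)` (a complement exists in finite dimension), the
map `Φ = (g, λ)` has invertible derivative, and the `C^ω` inverse function theorem
(`ContDiffAt.toOpenPartialHomeomorph`, `ContDiffAt.to_localInverse`) gives a local biholomorphism
`Φ`; then `e = Φ ∘ φ`, suitably shrunk.

Everything is proved; no definitions.

## References

* P. Griffiths, J. Harris, *Principles of Algebraic Geometry*, Wiley (1978), Ch. 0 §1 and §2
  pp. 18–20. [GriffithsHarris1978]
* K. Fritzsche, H. Grauert, *From Holomorphic Functions to Complex Manifolds*, GTM 213 (2002),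
  Ch. I §7 Thm. 7.6 (implicit functions). [FritzscheGrauert2002]
-/

noncomputable section

open scoped Manifold ContDiff Topology
open Set Filter Function Module

namespace Literature.Geometry.Kaehler

/-! ### Linear algebra: completing an onto map to an isomorphism -/

section LinearAlgebra

variable {E : Type*} [NormedAddCommGroup E] [NormedSpace ℂ E] [FiniteDimensional ℂ E]
  {p d : ℕ}

/-- **Completing an onto linear map to an isomorphism.** If `g' : E → ℂᵖ` is onto and
`dim E = p + d`, there is a linear `λ : E → ℂᵈ` with `(g', λ) : E → ℂᵖ × ℂᵈ` bijective (`λ` is an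
isomorphism `ker g' ≅ ℂᵈ` composed with a projection onto `ker g'`). [folklore] -/
theorem exists_prod_bijective (g' : E →L[ℂ] (Fin p → ℂ)) (hg' : Surjective g') (hd : finrank ℂ E = p + d) :
    ∃ lam : E →L[ℂ] (Fin d → ℂ), Bijective (g'.prod lam) := by
  set K : Submodule ℂ E := LinearMap.ker (g' : E →ₗ[ℂ] (Fin p → ℂ)) with hK
  -- `dim K = d`
  have hKd : finrank ℂ K = d := by
    have h1 := LinearMap.finrank_range_add_finrank_ker (g' : E →ₗ[ℂ] (Fin p → ℂ))
    rw [← hK] at h1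
    have h2 : finrank ℂ (LinearMap.range (g' : E →ₗ[ℂ] (Fin p → ℂ))) = p := by
      rw [LinearMap.range_eq_top.2 hg', finrank_top, finrank_fin_fun]
    omega
  have hKd' : finrank ℂ K = finrank ℂ (Fin d → ℂ) := by rw [hKd, finrank_fin_fun]
  obtain ⟨ψ⟩ : Nonempty (K ≃L[ℂ] (Fin d → ℂ)) := ⟨ContinuousLinearEquiv.ofFinrankEq hKd'⟩
  -- a projection onto `K`
  obtain ⟨π, hπ⟩ := LinearMap.exists_leftInverse_of_injective K.subtype (Submodule.ker_subtype K)
  set lam : E →L[ℂ] (Fin d → ℂ) := (ψ : K →L[ℂ] (Fin d → ℂ)).comp (LinearMap.toContinuousLinearMap π)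
    with hlam
  refine ⟨lam, ?_⟩
  -- injectivity, then bijectivity by the dimension count
  have hinj : Injective (g'.prod lam) := by
    intro v w hvw
    rw [← sub_eq_zero]
    set u := v - w with hu
    have h0 : (g'.prod lam) u = 0 := by rw [hu, map_sub, hvw, sub_self]
    have h1 : g' u = 0 := congrArg Prod.fst h0
    have h2 : lam u = 0 := congrArg Prod.snd h0
    have huK : u ∈ K := h1
    have hπu : π u = ⟨u, huK⟩ := by
      have := LinearMap.congr_fun hπ ⟨u, huK⟩
      simpa using this
    have h3 : ψ (π u) = 0 := h2
    rw [hπu, map_eq_zero_iff _ ψ.injective] at h3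
    exact congrArg Subtype.val h3
  have hdim : finrank ℂ E = finrank ℂ ((Fin p → ℂ) × (Fin d → ℂ)) := by
    rw [finrank_prod, finrank_fin_fun, finrank_fin_fun, hd]
  exact ⟨hinj, (LinearMap.injective_iff_surjective_of_finrank_eq_finrank hdim).1 hinj⟩

end LinearAlgebra

/-! ### The holomorphic straightening -/

section Straightening

variable {E : Type*} [NormedAddCommGroup E] [NormedSpace ℂ E] [FiniteDimensional ℂ E]
  {M : Type*} [TopologicalSpace M] [ChartedSpace E M] [IsManifold 𝓘(ℂ, E) ω M]
  {p d : ℕ}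

/-- **Holomorphic straightening (holomorphic implicit function theorem).** Let `f : M → ℂᵖ` be
holomorphic on an open `U ∋ x` of a complex manifold modelled on `E` with `dim E = p + d`, with onto
differential at `x`. Then there is an open partial homeomorphism `e : M ⇀ ℂᵖ × ℂᵈ` with
`x ∈ e.source ⊆ U`, holomorphic on its source with holomorphic inverse on its target, whose first
component is `f`: `(e y).1 = f y` on the source. [cite: GriffithsHarris1978, Ch. 0 §1 and §2 pp. 18–20]
[cite: FritzscheGrauert2002, Ch. I §7 Thm. 7.6] -/
theorem exists_holStraightening {f : M → (Fin p → ℂ)} {U : Set M} (hU : IsOpen U) {x : M} (hx : x ∈ U)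
    (hf : MDifferentiableOn 𝓘(ℂ, E) 𝓘(ℂ, Fin p → ℂ) f U)
    (hsurj : Surjective (mfderiv 𝓘(ℂ, E) 𝓘(ℂ, Fin p → ℂ) f x)) (hd : finrank ℂ E = p + d) :
    ∃ e : OpenPartialHomeomorph M ((Fin p → ℂ) × (Fin d → ℂ)), x ∈ e.source ∧ e.source ⊆ U ∧
      MDifferentiableOn 𝓘(ℂ, E) 𝓘(ℂ, (Fin p → ℂ) × (Fin d → ℂ)) e e.source ∧
      MDifferentiableOn 𝓘(ℂ, (Fin p → ℂ) × (Fin d → ℂ)) 𝓘(ℂ, E) e.symm e.target ∧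
      ∀ y ∈ e.source, (e y).1 = f y := by
  haveI : CompleteSpace E := FiniteDimensional.complete ℂ E
  set φ := chartAt E x with hφ
  have hxφ : x ∈ φ.source := mem_chart_source E x
  -- the chart expression `g = f ∘ φ⁻¹` is differentiable on the open `φ(U ∩ φ.source)`
  set W : Set M := U ∩ φ.source with hWdef
  have hW : IsOpen W := hU.inter φ.open_source
  have hxW : x ∈ W := ⟨hx, hxφ⟩
  have hmd : MDifferentiableOn 𝓘(ℂ, E) 𝓘(ℂ, Fin p → ℂ) f W := hf.mono inter_subset_left
  set g : E → (Fin p → ℂ) := f ∘ φ.symm with hgdef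
  have hdiff : DifferentiableOn ℂ g (φ '' W) := by
    have key := (mdifferentiableOn_iff_of_mem_maximalAtlas (I := 𝓘(ℂ, E)) (I' := 𝓘(ℂ, Fin p → ℂ))
      (e := φ) (e' := chartAt (Fin p → ℂ) (f x)) (f := f) (s := W) (IsManifold.chart_mem_maximalAtlas x)
      (IsManifold.chart_mem_maximalAtlas (f x)) inter_subset_right (fun z _ ↦ by simp)).1 hmd
    have h2 := key.2
    simp only [OpenPartialHomeomorph.extend_coe, OpenPartialHomeomorph.extend_coe_symm,
      modelWithCornersSelf_coe, modelWithCornersSelf_coe_symm, chartAt_self_eq,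
      OpenPartialHomeomorph.refl_apply, Function.id_comp, Function.comp_id] at h2
    exact h2
  have hopen : IsOpen (φ '' W) := by
    rw [hWdef, inter_comm, φ.image_source_inter_eq']
    exact φ.isOpen_inter_preimage_symm hU
  have hxW' : φ x ∈ φ '' W := mem_image_of_mem φ hxW
  -- hence analytic at `a = φ x`, with derivative the `mfderiv`, which is onto
  set a : E := φ x with ha
  have han : AnalyticAt ℂ g a := Literature.Analysis.Complex.SCV.analyticAt_of_differentiableOn hdiff hopen hxW'
  set g' : E →L[ℂ] (Fin p → ℂ) := fderiv ℂ g a with hg'def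
  have hmdx : MDifferentiableAt 𝓘(ℂ, E) 𝓘(ℂ, Fin p → ℂ) f x := hf.mdifferentiableAt (hU.mem_nhds hx)
  have hmf : mfderiv 𝓘(ℂ, E) 𝓘(ℂ, Fin p → ℂ) f x = g' := by
    rw [hmdx.mfderiv, ModelWithCorners.range_eq_univ, fderivWithin_univ]
    rfl
  have hg'surj : Surjective g' := by rw [← hmf]; exact hsurj
  -- complete `g'` to an isomorphism and apply the inverse function theorem to `Φ = (g, λ)`
  obtain ⟨lam, hbij⟩ := exists_prod_bijective g' hg'surj hd
  have hdimE : finrank ℂ E = finrank ℂ ((Fin p → ℂ) × (Fin d → ℂ)) := by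
    rw [finrank_prod, finrank_fin_fun, finrank_fin_fun, hd]
  set Leq : E ≃L[ℂ] ((Fin p → ℂ) × (Fin d → ℂ)) :=
    ((g'.prod lam : E →ₗ[ℂ] _).linearEquivOfInjective hbij.1 hdimE).toContinuousLinearEquiv with hLeq
  have hLeq_coe : (Leq : E →L[ℂ] ((Fin p → ℂ) × (Fin d → ℂ))) = g'.prod lam := by
    ext v <;> rfl
  set Φ : E → (Fin p → ℂ) × (Fin d → ℂ) := fun y ↦ (g y, lam y) with hΦdef
  have hΦan : AnalyticAt ℂ Φ a := han.prod (lam.analyticAt a)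
  have hΦcd : ContDiffAt ℂ ω Φ a := hΦan.contDiffAt
  have hΦ' : HasFDerivAt Φ (Leq : E →L[ℂ] ((Fin p → ℂ) × (Fin d → ℂ))) a := by
    rw [hLeq_coe]
    exact han.differentiableAt.hasFDerivAt.prodMk (lam.hasFDerivAt)
  have hω : (ω : WithTop ℕ∞) ≠ 0 := by simp
  set e₀ := hΦcd.toOpenPartialHomeomorph Φ hΦ' hω with he₀
  have he₀_coe : (e₀ : E → (Fin p → ℂ) × (Fin d → ℂ)) = Φ := rfl
  have hae₀ : a ∈ e₀.source := hΦcd.mem_toOpenPartialHomeomorph_source hΦ' hω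
  -- the inverse is analytic near `Φ a`
  have hsymm_an : AnalyticAt ℂ e₀.symm (Φ a) := by
    have h := hΦcd.to_localInverse hΦ' hω
    exact h.analyticAt
  obtain ⟨T₁, hT₁sub, hT₁open, haT₁⟩ : ∃ T₁ : Set ((Fin p → ℂ) × (Fin d → ℂ)),
      T₁ ⊆ {w | AnalyticAt ℂ e₀.symm w} ∧ IsOpen T₁ ∧ Φ a ∈ T₁ :=
    mem_nhds_iff.1 hsymm_an.eventually_analyticAt
  -- shrink `e₀` to `S = φ(W) ∩ Φ⁻¹(T₁)`
  set S : Set E := φ '' W ∩ Φ ⁻¹' T₁ with hS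
  have hΦcont : ContinuousOn Φ (φ '' W) := (hdiff.continuousOn).prodMk lam.continuous.continuousOn
  have hSopen : IsOpen S := hΦcont.isOpen_inter_preimage hopen hT₁open
  have haS : a ∈ S := ⟨hxW', haT₁⟩
  set e₁ := e₀.restrOpen S hSopen with he₁
  have he₁_source : e₁.source = e₀.source ∩ S := e₀.restrOpen_source S hSopen
  have he₁_target : e₁.target = e₀.target ∩ e₀.symm ⁻¹' S := by
    have h := congrArg PartialEquiv.target (e₀.restrOpen_toPartialEquiv S hSopen)
    rw [PartialEquiv.restr_target] at h
    exact h
  have hae₁ : a ∈ e₁.source := by rw [he₁_source]; exact ⟨hae₀, haS⟩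
  -- holomorphy of `e₁` and `e₁⁻¹`
  have hΦdiff : DifferentiableOn ℂ Φ (φ '' W) := hdiff.prodMk lam.differentiable.differentiableOn
  have he₁diff : MDifferentiableOn 𝓘(ℂ, E) 𝓘(ℂ, (Fin p → ℂ) × (Fin d → ℂ)) e₁ e₁.source := by
    rw [mdifferentiableOn_iff_differentiableOn]
    refine (hΦdiff.mono ?_).congr fun y _ ↦ rfl
    rw [he₁_source]
    exact fun y hy ↦ hy.2.1
  have he₁symm : MDifferentiableOn 𝓘(ℂ, (Fin p → ℂ) × (Fin d → ℂ)) 𝓘(ℂ, E) e₁.symm e₁.target := by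
    rw [mdifferentiableOn_iff_differentiableOn]
    intro w hw
    rw [he₁_target] at hw
    -- `w = e₀ (e₀.symm w) = Φ (e₀.symm w) ∈ T₁`
    have hw' : w ∈ T₁ := by
      have h1 : e₀ (e₀.symm w) = w := e₀.right_inv hw.1
      rw [← h1, he₀_coe]
      exact hw.2.2
    exact (hT₁sub hw').differentiableAt.differentiableWithinAt
  -- compose with the chart
  set e := φ.trans e₁ with hedef
  have hxe : x ∈ e.source := by
    rw [hedef, OpenPartialHomeomorph.trans_source]
    exact ⟨hxφ, hae₁⟩
  refine ⟨e, hxe, ?_, ?_, ?_, ?_⟩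
  · -- `e.source ⊆ U`
    intro y hy
    rw [hedef, OpenPartialHomeomorph.trans_source] at hy
    have hy2 : φ y ∈ S := by
      have := hy.2
      rw [mem_preimage, he₁_source] at this
      exact this.2
    obtain ⟨u, huW, hu⟩ := hy2.1
    have : u = y := by
      have h1 := φ.left_inv huW.2
      have h2 := φ.left_inv hy.1
      rw [← h1, ← h2, hu]
    rw [← this]
    exact huW.1
  · -- holomorphy of `e = e₁ ∘ φ`
    have hφ' : MDifferentiableOn 𝓘(ℂ, E) 𝓘(ℂ, E) φ φ.source :=
      mdifferentiableOn_atlas (I := 𝓘(ℂ, E)) (chart_mem_atlas E x)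
    have h : MDifferentiableOn 𝓘(ℂ, E) 𝓘(ℂ, (Fin p → ℂ) × (Fin d → ℂ)) (e₁ ∘ φ) e.source := by
      refine he₁diff.comp (hφ'.mono ?_) ?_
      · rw [hedef, OpenPartialHomeomorph.trans_source]
        exact inter_subset_left
      · intro y hy
        rw [hedef, OpenPartialHomeomorph.trans_source] at hy
        exact hy.2
    exact h.congr fun y _ ↦ rfl
  · -- holomorphy of `e⁻¹ = φ⁻¹ ∘ e₁⁻¹`
    have hφ's : MDifferentiableOn 𝓘(ℂ, E) 𝓘(ℂ, E) φ.symm φ.target :=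
      mdifferentiableOn_atlas_symm (I := 𝓘(ℂ, E)) (chart_mem_atlas E x)
    have h : MDifferentiableOn 𝓘(ℂ, (Fin p → ℂ) × (Fin d → ℂ)) 𝓘(ℂ, E) (φ.symm ∘ e₁.symm) e.target := by
      refine hφ's.comp (he₁symm.mono ?_) ?_
      · rw [hedef, OpenPartialHomeomorph.trans_target]
        exact inter_subset_left
      · intro w hw
        rw [hedef, OpenPartialHomeomorph.trans_target] at hw
        exact hw.2
    exact h.congr fun w _ ↦ rfl
  · -- first component
    intro y hy
    rw [hedef, OpenPartialHomeomorph.trans_source] at hy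
    change (e₁ (φ y)).1 = f y
    rw [he₁, OpenPartialHomeomorph.coe_restrOpen, he₀_coe]
    change f (φ.symm (φ y)) = f y
    rw [φ.left_inv hy.1]

end Straightening

end Literature.Geometry.Kaehler
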